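import Mathlib
import Literature.Analysis.FluidPDE.VectorCalculus
import Summits.NavierStokesRegularity.NavierStokesRegularity.Theorems.FilamentSkeletonRssClause13REdgeMeasureModel

/-!
# Clause 13-R/13-J at MODEL level: the FORWARD energy identity — the model operator is coercive in `L²` on clamped fields, Γ-uniformly
# (crux `Clause13RNearStraightL`, stmt-NavierStokesRegularity-23612; line `rate_bordered_split`, stubs `stub_rateRow13RFlat` / `stub_clamped13JBordered`)

Route `FilamentSkeletonRss`, Variant A1R.  Forward model operator of `…Clause13REdgeMeasureModel` on the ball `S = [a,b]`:
`(LY)(σ) = cst • (m σ • (d × Y σ) − ∫_{τ∈S} k(τ−σ) • (d × Y τ) dτ) + ½ Y σ − α e × Y σ − w σ • Y′ σ`.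
The adjoint-side identity `…Clause13RAdjointEnergy.model_adjoint_energy_identity` has a forward twin WITHOUT boundary terms on the CLAMPED class: for
`Y ∈ C²` vanishing off `S`,
  `∫_a^b ⟪LY, Y⟫ = ∫_a^b ½(1 + w′)‖Y‖²`      (`model_forward_energy_identity`),
because `⟪d × Y, Y⟫ = 0 = ⟪e × Y, Y⟫` pointwise, the nonlocal term pairs to zero over `S × S` (even kernel, alternating triple product —
`setIntegral_inner_forward_nonlocal_eq_zero`), and `−∫ w⟪Y′, Y⟫ = ½∫ w′‖Y‖²` (`Y(a) = Y(b) = 0`).  Hence the Γ-UNIFORM weak coercivity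
`ε ∫_a^b ‖Y‖² ≤ ∫_a^b ⟪LY, Y⟫ ≤ ‖LY‖₂‖Y‖₂` whenever `w′ ≥ −1 + 2ε` (`model_forward_coercive`): at model level the operator is injective with an `L²`
a-priori bound of constant `1/ε` independent of `Γ, R_b, cst, m, k, α` (the conservative LIA/rotation part is invisible to the energy), so ALL the
content of the rate row is in the cokernel — the edge measures of `…Clause13REdgeMeasureModel{,Converse}`.  (This weak bound does not replace the
MatchedKernel layer's `model_l2_estimate`, whose point is the anisotropic-strain term and the sharp constant; it is the `β₂ = 0` energy baseline.)
[folklore]  Hand `leafhand-ns-filamentskeletonrs-16-g0` (LAND-ONLY); `--supports stmt-NavierStokesRegularity-23612` helper, def-free.  HONEST FRAMING: an identity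
for the MODEL operator attached to a HYPOTHETICAL filament skeleton on the NEGATIVE side of a MODEL blow-up route; neither stub is proved here and nothing in this
file bears on Navier–Stokes regularity or blow-up.
-/

noncomputable section

open MeasureTheory Filter Topology Set intervalIntegral
open scoped RealInnerProductSpace InnerProductSpace
open Literature.Analysis.FluidPDE
open Summit.NavierStokesRegularity.NavierStokesRegularity.Theorems.Clause13REdgeMeasureModel (inner_cross_transpose clamped_endpoints)
open Summit.NavierStokesRegularity.NavierStokesRegularity.Theorems.Clause13RAdjointEnergy (inner_cross_left_swap)

namespace Summit.NavierStokesRegularity.NavierStokesRegularity.Theorems.Clause13RModelForwardEnergy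
set_option linter.dupNamespace false

/-! ## §1 The forward nonlocal term is conservative -/

/-- Antisymmetry of the forward nonlocal density: `k(τ−σ)⟪d × Y τ, Y σ⟫ = −(k(σ−τ)⟪d × Y σ, Y τ⟫)` for an even kernel. [folklore] -/
theorem forward_density_antisymm {k : ℝ → ℝ} (hkev : ∀ s, k (-s) = k s) (Y : ℝ → EuclideanSpace ℝ (Fin 3))
    (d : EuclideanSpace ℝ (Fin 3)) (σ τ : ℝ) :
    k (τ - σ) * ⟪cross d (Y τ), Y σ⟫ = -(k (σ - τ) * ⟪cross d (Y σ), Y τ⟫) := by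
  have hk : k (τ - σ) = k (σ - τ) := by rw [← hkev (σ - τ), neg_sub]
  have h1 : ⟪cross d (Y τ), Y σ⟫ = -⟪cross d (Y σ), Y τ⟫ := by
    simp only [cross, cross_apply, PiLp.inner_apply, RCLike.inner_apply, conj_trivial, Fin.sum_univ_three,
      Matrix.cons_val_zero, Matrix.cons_val_one, Matrix.cons_val_two, Matrix.head_cons, Matrix.tail_cons]
    ring
  rw [hk, h1]; ring

/-- **The forward nonlocal term pairs to zero**: `∫_{σ∈S} ⟪∫_{τ∈S} k(τ−σ) • (d × Y τ) dτ, Y σ⟫ dσ = 0` (continuous even `k`, continuous `Y`). [folklore] -/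
theorem setIntegral_inner_forward_nonlocal_eq_zero {a b : ℝ} {k : ℝ → ℝ} (hk : Continuous k) (hkev : ∀ s, k (-s) = k s)
    {Y : ℝ → EuclideanSpace ℝ (Fin 3)} (hY : Continuous Y) (d : EuclideanSpace ℝ (Fin 3)) :
    ∫ σ in Icc a b, ⟪∫ τ in Icc a b, k (τ - σ) • cross d (Y τ), Y σ⟫ = 0 := by
  set F : ℝ → ℝ → ℝ := fun σ τ => k (τ - σ) * ⟪cross d (Y τ), Y σ⟫ with hF
  have hcrossY : Continuous fun τ => cross d (Y τ) := by
    have : Continuous fun τ => crossCLM d (Y τ) := (crossCLM.continuous₂).comp₂ continuous_const hY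
    simpa only [crossCLM_apply] using this
  have hFc : Continuous (Function.uncurry F) := by
    have h1 : Continuous fun p : ℝ × ℝ => k (p.2 - p.1) := hk.comp (continuous_snd.sub continuous_fst)
    have h2 : Continuous fun p : ℝ × ℝ => ⟪cross d (Y p.2), Y p.1⟫ :=
      (hcrossY.comp continuous_snd).inner (hY.comp continuous_fst)
    exact h1.mul h2
  have hinner : ∀ σ, ⟪∫ τ in Icc a b, k (τ - σ) • cross d (Y τ), Y σ⟫ = ∫ τ in Icc a b, F σ τ := by
    intro σ
    have hint : IntegrableOn (fun τ => k (τ - σ) • cross d (Y τ)) (Icc a b) :=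
      ((hk.comp (continuous_id.sub continuous_const)).smul hcrossY).continuousOn.integrableOn_compact isCompact_Icc
    rw [real_inner_comm, ← integral_inner hint (Y σ)]
    refine integral_congr_ae (Eventually.of_forall fun τ => ?_)
    simp only [hF, inner_smul_right, real_inner_comm (Y σ)]
  simp_rw [hinner]
  have hprod : Integrable (Function.uncurry F) ((volume.restrict (Icc a b)).prod (volume.restrict (Icc a b))) := by
    rw [Measure.prod_restrict]
    exact hFc.continuousOn.integrableOn_compact (isCompact_Icc.prod isCompact_Icc)
  have hswap : ∫ σ in Icc a b, ∫ τ in Icc a b, F σ τ = ∫ τ in Icc a b, ∫ σ in Icc a b, F σ τ :=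
    integral_integral_swap hprod
  have hanti : ∫ τ in Icc a b, ∫ σ in Icc a b, F σ τ = -∫ τ in Icc a b, ∫ σ in Icc a b, F τ σ := by
    rw [← MeasureTheory.integral_neg]
    refine integral_congr_ae (Eventually.of_forall fun τ => ?_)
    simp only
    rw [← MeasureTheory.integral_neg]
    refine integral_congr_ae (Eventually.of_forall fun σ => ?_)
    simp only [hF]
    exact forward_density_antisymm hkev Y d σ τ
  have hself : ∫ σ in Icc a b, ∫ τ in Icc a b, F σ τ = -∫ σ in Icc a b, ∫ τ in Icc a b, F σ τ := hswap.trans hanti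
  linarith

/-! ## §2 The forward energy identity on clamped fields and the weak coercivity -/

/-- **FORWARD ENERGY IDENTITY (model, clamped class).**  For `a < b`, continuous even `k`, any `m`, `w ∈ C¹`, and `Y ∈ C²` vanishing off `[a,b]`:
`∫_a^b ⟪LY, Y⟫ = ∫_a^b ½(1 + w′)‖Y‖²`. [folklore] -/
theorem model_forward_energy_identity {a b cst α : ℝ} (hab : a < b) {k m w w' : ℝ → ℝ} {d e : EuclideanSpace ℝ (Fin 3)}
    (hk : Continuous k) (hkev : ∀ s, k (-s) = k s)
    (hw : ∀ σ, HasDerivAt w (w' σ) σ) (hw'c : Continuous w')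
    {Y : ℝ → EuclideanSpace ℝ (Fin 3)} (hY : ContDiff ℝ 2 Y) (hoff : ∀ τ, τ ∉ Icc a b → Y τ = 0) :
    ∫ σ in a..b, ⟪cst • (m σ • cross d (Y σ) - ∫ τ in Icc a b, k (τ - σ) • cross d (Y τ))
        + (1 / 2 : ℝ) • Y σ - α • cross e (Y σ) - w σ • deriv Y σ, Y σ⟫
      = ∫ σ in a..b, 1 / 2 * (1 + w' σ) * ‖Y σ‖ ^ 2 := by
  have hwc : Continuous w := continuous_iff_continuousAt.2 fun σ => (hw σ).continuousAt
  have hYc : Continuous Y := hY.continuous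
  have hY'c : Continuous (deriv Y) := hY.continuous_deriv (by norm_num)
  have hYd : ∀ σ, HasDerivAt Y (deriv Y σ) σ := fun σ => (hY.differentiable (by norm_num) σ).hasDerivAt
  obtain ⟨hYa, -, hYb, -⟩ := clamped_endpoints hY hoff
  -- pointwise orthogonalities
  have hd0 : ∀ σ, ⟪cross d (Y σ), Y σ⟫ = 0 := fun σ => by
    simp only [cross, cross_apply, PiLp.inner_apply, RCLike.inner_apply, conj_trivial, Fin.sum_univ_three,
      Matrix.cons_val_zero, Matrix.cons_val_one, Matrix.cons_val_two, Matrix.head_cons, Matrix.tail_cons]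
    ring
  have he0 : ∀ σ, ⟪cross e (Y σ), Y σ⟫ = 0 := fun σ => by
    simp only [cross, cross_apply, PiLp.inner_apply, RCLike.inner_apply, conj_trivial, Fin.sum_univ_three,
      Matrix.cons_val_zero, Matrix.cons_val_one, Matrix.cons_val_two, Matrix.head_cons, Matrix.tail_cons]
    ring
  -- pointwise split of the pairing
  have hsplit : ∀ σ, ⟪cst • (m σ • cross d (Y σ) - ∫ τ in Icc a b, k (τ - σ) • cross d (Y τ))
        + (1 / 2 : ℝ) • Y σ - α • cross e (Y σ) - w σ • deriv Y σ, Y σ⟫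
      = -cst * ⟪∫ τ in Icc a b, k (τ - σ) • cross d (Y τ), Y σ⟫ + 1 / 2 * ‖Y σ‖ ^ 2 - w σ * ⟪deriv Y σ, Y σ⟫ := by
    intro σ
    simp only [inner_add_left, inner_sub_left, inner_smul_left, conj_trivial, hd0, he0, real_inner_self_eq_norm_sq]
    ring
  -- continuity of the nonlocal term
  have hcrossY : Continuous fun τ => cross d (Y τ) := by
    have : Continuous fun τ => crossCLM d (Y τ) := (crossCLM.continuous₂).comp₂ continuous_const hYc
    simpa only [crossCLM_apply] using this
  have hN : Continuous fun σ => ∫ τ in Icc a b, k (τ - σ) • cross d (Y τ) := by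
    have hj : Continuous (Function.uncurry fun σ τ => k (τ - σ) • cross d (Y τ)) :=
      (hk.comp (continuous_snd.sub continuous_fst)).smul (hcrossY.comp continuous_snd)
    exact continuous_parametric_integral_of_continuous hj isCompact_Icc
  have hi1 : IntervalIntegrable (fun σ => -cst * ⟪∫ τ in Icc a b, k (τ - σ) • cross d (Y τ), Y σ⟫) volume a b :=
    (continuous_const.mul (hN.inner hYc)).intervalIntegrable _ _
  have hi2 : IntervalIntegrable (fun σ => 1 / 2 * ‖Y σ‖ ^ 2) volume a b :=
    (continuous_const.mul (hYc.norm.pow 2)).intervalIntegrable _ _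
  have hi3 : IntervalIntegrable (fun σ => w σ * ⟪deriv Y σ, Y σ⟫) volume a b :=
    (hwc.mul (hY'c.inner hYc)).intervalIntegrable _ _
  rw [intervalIntegral.integral_congr (fun σ _ => hsplit σ), intervalIntegral.integral_sub (hi1.add hi2) hi3,
    intervalIntegral.integral_add hi1 hi2, intervalIntegral.integral_const_mul]
  -- nonlocal integral vanishes
  have hN0 : ∫ σ in a..b, ⟪∫ τ in Icc a b, k (τ - σ) • cross d (Y τ), Y σ⟫ = 0 := by
    rw [integral_of_le hab.le, ← integral_Icc_eq_integral_Ioc]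
    exact setIntegral_inner_forward_nonlocal_eq_zero hk hkev hYc d
  -- transport: `∫ (w′‖Y‖² + 2w⟪Y′,Y⟫) = 0` on the clamped class
  have hT := Clause13RAdjointEnergy.integral_transport_eq (a := a) (b := b) hw hYd hw'c hY'c
  rw [hYa, hYb, norm_zero] at hT
  simp only [ne_eq, OfNat.ofNat_ne_zero, not_false_eq_true, zero_pow, mul_zero, sub_self] at hT
  have hi4 : IntervalIntegrable (fun σ => w' σ * ‖Y σ‖ ^ 2) volume a b := (hw'c.mul (hYc.norm.pow 2)).intervalIntegrable _ _
  have hi5 : IntervalIntegrable (fun σ => 2 * w σ * ⟪deriv Y σ, Y σ⟫) volume a b :=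
    ((continuous_const.mul hwc).mul (hY'c.inner hYc)).intervalIntegrable _ _
  rw [intervalIntegral.integral_add hi4 hi5] at hT
  have h5 : ∫ σ in a..b, 2 * w σ * ⟪deriv Y σ, Y σ⟫ = 2 * ∫ σ in a..b, w σ * ⟪deriv Y σ, Y σ⟫ := by
    rw [← intervalIntegral.integral_const_mul]
    refine intervalIntegral.integral_congr fun σ _ => ?_
    ring
  rw [h5] at hT
  -- assemble
  have hR : ∫ σ in a..b, 1 / 2 * (1 + w' σ) * ‖Y σ‖ ^ 2 = (∫ σ in a..b, 1 / 2 * ‖Y σ‖ ^ 2) + 1 / 2 * ∫ σ in a..b, w' σ * ‖Y σ‖ ^ 2 := by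
    rw [← intervalIntegral.integral_const_mul, ← intervalIntegral.integral_add hi2 (hi4.const_mul _)]
    refine intervalIntegral.integral_congr fun σ _ => ?_
    ring
  rw [hN0, hR]
  linarith

/-- **WEAK COERCIVITY of the forward model operator on the clamped class, Γ-uniform.**  If moreover `w′ ≥ −1 + 2ε` on `[a,b]` then
`ε ∫_a^b ‖Y‖² ≤ ∫_a^b ⟪LY, Y⟫` (hence `≤ ‖LY‖₂‖Y‖₂`): an `L²` a-priori bound with constant `1/ε` independent of `Γ, R_b, cst, m, k, α`. [folklore] -/
theorem model_forward_coercive {a b cst α ε : ℝ} (hab : a < b) {k m w w' : ℝ → ℝ} {d e : EuclideanSpace ℝ (Fin 3)}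
    (hk : Continuous k) (hkev : ∀ s, k (-s) = k s)
    (hw : ∀ σ, HasDerivAt w (w' σ) σ) (hw'c : Continuous w') (hgrowth : ∀ σ ∈ Icc a b, -1 + 2 * ε ≤ w' σ)
    {Y : ℝ → EuclideanSpace ℝ (Fin 3)} (hY : ContDiff ℝ 2 Y) (hoff : ∀ τ, τ ∉ Icc a b → Y τ = 0) :
    ε * ∫ σ in a..b, ‖Y σ‖ ^ 2
      ≤ ∫ σ in a..b, ⟪cst • (m σ • cross d (Y σ) - ∫ τ in Icc a b, k (τ - σ) • cross d (Y τ))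
          + (1 / 2 : ℝ) • Y σ - α • cross e (Y σ) - w σ • deriv Y σ, Y σ⟫ := by
  have hYc : Continuous Y := hY.continuous
  rw [model_forward_energy_identity hab hk hkev hw hw'c hY hoff, ← intervalIntegral.integral_const_mul]
  refine intervalIntegral.integral_mono_on hab.le ((continuous_const.mul (hYc.norm.pow 2)).intervalIntegrable _ _)
    (((continuous_const.mul (continuous_const.add hw'c)).mul (hYc.norm.pow 2)).intervalIntegrable _ _) fun σ hσ => ?_
  have h1 := hgrowth σ hσ
  have h2 : 0 ≤ ‖Y σ‖ ^ 2 := sq_nonneg _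
  nlinarith

end Summit.NavierStokesRegularity.NavierStokesRegularity.Theorems.Clause13RModelForwardEnergy

end
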